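import Summits.QuantumFields.YangMills.Theorems.SqueezedSkewnessTorusKLClassSums
import HarnessLib

/-!
# ENGINE-KL layer (K4e) for `SqueezedSkewness.TorusKL` (stmt-QuantumFields-23204, stub `stub_torusMixtureData`):
# THE FINITE-PERIOD KÄLLÉN–LEHMANN MIXTURE ON `L²(slices; ℂ)`

★ `exists_torus_mixture`: for continuous unitary `ρ`, `β ≥ 0`, spatial period `S` and time period `K + 1 ≥ 5` there are a countable
index `κ` (pairs: eigenvalue class `c > 0` of the transfer operator, joint eigenvector `e` of class `c` with momentum `q`), weights
`p_k = c^{K−1}/Z ≥ 0`, a constant `W₀ ≥ 0` (the VARIANCE ATOM, `Σ π|d|² − (Σ π d)²` by Cauchy–Schwarz), compact self-adjoint positive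
operators `P_k = c⁻¹ (1−|e⟩⟨e|) A' (1−|e⟩⟨e|)`, norm-preserving representations `Ũ_k(γ) = conj χ_q(γ) · U'_{v(γ)}` of `(ℤ/S)³` commuting with
`P_k`, and vectors `ψ_k`, such that for EVERY real coefficient function `cf` on the sites of times `1 ≤ t ≤ h`, `2h + 3 ≤ K + 1`, with
`B = Σ cf(x) A(x, ·)` (`A(x,U)` = the six plaquette traces at `x`, `θ` = the item's site reflection, `E = ∫ · e^{−βS} / Z`):
`E[(B∘θ)·B] − E[B∘θ]E[B] − W₀ (Σ cf)² = Σ_k p_k ‖Σ_x cf(x) P_k^{t−1} Ũ_k(x⃗) ψ_k‖²` (`HasSum`).  Assembly of the CLASS SUMS of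
`…TorusKLClassSums` (layers K3, K4c, K4d underneath).  Seat `ym-line-fcl-p3` g16; route-independent imports;
`[folklore]` (Lüscher 1977; Montvay–Münster §3.2.6 (3.145); Reed–Simon I §VI); nothing about a summit, NT or the mass gap is proved.
-/

set_option autoImplicit false

noncomputable section

open MeasureTheory Filter Function
open scoped InnerProductSpace ComplexConjugate ENNReal BigOperators
open Literature.MathematicalPhysics.QuantumFieldTheory Literature.Barriers.QuantumFields
open Literature.Analysis.OperatorTheory

namespace Summit.QuantumFields.YangMills.Theorems.TorusKL

variable {S : ℕ} [NeZero S] {G : Type*} [Group G] [TopologicalSpace G] [IsTopologicalGroup G] [CompactSpace G] [MeasurableSpace G]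
  [BorelSpace G] [SecondCountableTopology G] {N : ℕ} (ρ : G →* Matrix (Fin N) (Fin N) ℂ) (β : ℝ)

omit [NeZero S] in
/-- Integrability of a continuous function on the (compact) link-configuration space against the product Haar measure. [folklore] -/
theorem integrable_of_continuous_cfg {T : ℕ} {F : (FinTorusSite S S S T × Fin 4 → G) → ℝ} (hF : Continuous F) :
    Integrable F (Measure.pi fun _ : FinTorusSite S S S T × Fin 4 => haarProbability G) :=
  hF.integrable_of_hasCompactSupport (HasCompactSupport.of_compactSpace F)

omit [NeZero S] [CompactSpace G] [MeasurableSpace G] [BorelSpace G] [SecondCountableTopology G] in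
/-- Continuity of the six plaquette traces at a site in the link configuration. [folklore] -/
theorem continuous_sitePlaquettes (hρ : Continuous ρ) {T : ℕ} (x : FinTorusSite S S S T) :
    Continuous fun U : FinTorusSite S S S T × Fin 4 → G =>
      ∑ q : {q : Fin 4 × Fin 4 // q.1 < q.2}, (ρ (finTorusPlaquette U x q.1.1 q.1.2)).trace.re := by
  have htr : Continuous fun g : G => (ρ g).trace.re := Complex.continuous_re.comp (Continuous.matrix_trace hρ)
  have hU : ∀ l : FinTorusSite S S S T × Fin 4, Continuous fun U : FinTorusSite S S S T × Fin 4 → G => U l :=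
    fun l => continuous_apply l
  refine continuous_finsetSum _ fun q _ => htr.comp ?_
  unfold finTorusPlaquette
  exact (((hU _).mul (hU _)).mul (hU _).inv).mul (hU _).inv

omit [NeZero S] [CompactSpace G] [SecondCountableTopology G] [MeasurableSpace G] [BorelSpace G] in
/-- Continuity of the item's site reflection. [folklore] -/
theorem continuous_reflCfg' {T : ℕ} :
    Continuous fun (U : FinTorusSite S S S T × Fin 4 → G) (e : FinTorusSite S S S T × Fin 4) =>
      if e.2 = Fin.last 3 then (U ((e.1.1, e.1.2.1, e.1.2.2.1, Fin.rev e.1.2.2.2), Fin.last 3))⁻¹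
      else U ((e.1.1, e.1.2.1, e.1.2.2.1, ⟨(T - e.1.2.2.2.val) % T, Nat.mod_lt _ e.1.2.2.2.pos⟩), e.2) := by
  refine continuous_pi fun e => ?_
  by_cases h : e.2 = Fin.last 3
  · simp only [h, if_true]; exact (continuous_apply _).inv
  · simp only [h, if_false]; exact continuous_apply _

omit [NeZero S] [CompactSpace G] [MeasurableSpace G] [BorelSpace G] [SecondCountableTopology G] in
/-- Continuity of the Wilson weight. [folklore] -/
theorem continuous_weight (hρ : Continuous ρ) {T : ℕ} :
    Continuous fun U : FinTorusSite S S S T × Fin 4 → G =>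
      Real.exp (-β * ∑ x : FinTorusSite S S S T, ∑ q : {q : Fin 4 × Fin 4 // q.1 < q.2},
        ((N : ℝ) - (ρ (finTorusPlaquette U x q.1.1 q.1.2)).trace.re)) := by
  have htr : Continuous fun g : G => (ρ g).trace.re := Complex.continuous_re.comp (Continuous.matrix_trace hρ)
  have hU : ∀ l : FinTorusSite S S S T × Fin 4, Continuous fun U : FinTorusSite S S S T × Fin 4 → G => U l :=
    fun l => continuous_apply l
  refine (continuous_const.mul (continuous_finsetSum _ fun x _ => continuous_finsetSum _ fun q _ =>
    continuous_const.sub (htr.comp ?_))).rexp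
  unfold finTorusPlaquette
  exact (((hU _).mul (hU _)).mul (hU _).inv).mul (hU _).inv

set_option maxHeartbeats 800000 in
/-- ★ **THE FINITE-PERIOD KÄLLÉN–LEHMANN MIXTURE on `L²(slices; ℂ)`** (see the module docstring): for `K ≥ 4` there are countably many
reference states `k` with weights `p_k ≥ 0`, a variance atom `W₀ ≥ 0`, compact self-adjoint positive `P_k`, norm-preserving representations
`Ũ_k` of `(ℤ/S)³` commuting with `P_k`, and vectors `ψ_k` such that for every coefficient function `cf` living on the times `1 ≤ t ≤ h`,
`2h + 3 ≤ K + 1`:  `E[(B∘θ)B] − E[B∘θ] E[B] − W₀ (Σ cf)² = Σ_k p_k ‖Σ_{t,q} cf t q • P_k^{t−1} Ũ_k(q) ψ_k‖²`.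
[cite: Luscher1977] [cite: MontvayMunster1994, §3.2.6 (3.145)] [cite: ReedSimonI1980, Thm VI.23] -/
theorem exists_torus_mixture (hρ : Continuous ρ) (hρu : ∀ g, ρ g ∈ Matrix.unitaryGroup (Fin N) ℂ) (hβ : 0 ≤ β) {K : ℕ} (hK : 4 ≤ K) :
    ∃ (κ : Type) (_ : Countable κ) (pw : κ → ℝ) (W₀ : ℝ)
      (P : κ → Lp ℂ 2 (Measure.pi fun _ : FinSpatialSite S S S × Fin 3 => haarProbability G) →L[ℂ]
        Lp ℂ 2 (Measure.pi fun _ : FinSpatialSite S S S × Fin 3 => haarProbability G))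
      (Ut : κ → (Fin 3 → ZMod S) → Lp ℂ 2 (Measure.pi fun _ : FinSpatialSite S S S × Fin 3 => haarProbability G) →L[ℂ]
        Lp ℂ 2 (Measure.pi fun _ : FinSpatialSite S S S × Fin 3 => haarProbability G))
      (ψ : κ → Lp ℂ 2 (Measure.pi fun _ : FinSpatialSite S S S × Fin 3 => haarProbability G)),
      (∀ k, 0 ≤ pw k) ∧ 0 ≤ W₀ ∧
      (∀ k, IsSelfAdjoint (P k) ∧ IsCompactOperator (P k) ∧ (∀ v, 0 ≤ RCLike.re ⟪P k v, v⟫_ℂ) ∧ Ut k 0 = 1 ∧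
        (∀ x y, Ut k (x + y) = Ut k x * Ut k y) ∧ (∀ x v, ‖Ut k x v‖ = ‖v‖) ∧ (∀ x, P k * Ut k x = Ut k x * P k)) ∧
      ∀ (h : ℕ) (_ : 2 * h + 3 ≤ K + 1) (cf : Fin (K + 1) → FinSpatialSite S S S → ℝ)
        (_ : ∀ (t : Fin (K + 1)) q, ¬ (1 ≤ (t : ℕ) ∧ (t : ℕ) ≤ h) → cf t q = 0),
        HasSum (fun k => pw k * ‖∑ t : Fin (K + 1), ∑ q : FinSpatialSite S S S,
            (cf t q : ℂ) • ((P k ^ ((t : ℕ) - 1)) (Ut k ![ZMod.finEquiv S q.1, ZMod.finEquiv S q.2.1, ZMod.finEquiv S q.2.2] (ψ k)))‖ ^ 2)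
          ((∫ U : FinTorusSite S S S (K + 1) × Fin 4 → G,
              ((∑ t : Fin (K + 1), ∑ q : FinSpatialSite S S S, cf t q *
                  ∑ pl : {q : Fin 4 × Fin 4 // q.1 < q.2}, (ρ (finTorusPlaquette
                    (fun e : FinTorusSite S S S (K + 1) × Fin 4 => if e.2 = Fin.last 3 then
                      (U ((e.1.1, e.1.2.1, e.1.2.2.1, Fin.rev e.1.2.2.2), Fin.last 3))⁻¹
                    else U ((e.1.1, e.1.2.1, e.1.2.2.1, ⟨(K + 1 - e.1.2.2.2.val) % (K + 1), Nat.mod_lt _ e.1.2.2.2.pos⟩), e.2))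
                    (q.toSite t) pl.1.1 pl.1.2)).trace.re) *
                (∑ t : Fin (K + 1), ∑ q : FinSpatialSite S S S, cf t q *
                  ∑ pl : {q : Fin 4 × Fin 4 // q.1 < q.2}, (ρ (finTorusPlaquette U (q.toSite t) pl.1.1 pl.1.2)).trace.re)) *
              Real.exp (-β * ∑ x : FinTorusSite S S S (K + 1), ∑ q : {q : Fin 4 × Fin 4 // q.1 < q.2},
                ((N : ℝ) - (ρ (finTorusPlaquette U x q.1.1 q.1.2)).trace.re))
              ∂(Measure.pi fun _ : FinTorusSite S S S (K + 1) × Fin 4 => haarProbability G)) /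
              wilsonFinTorusPartition ρ β S S S (K + 1) -
            (∫ U : FinTorusSite S S S (K + 1) × Fin 4 → G,
              (∑ t : Fin (K + 1), ∑ q : FinSpatialSite S S S, cf t q *
                  ∑ pl : {q : Fin 4 × Fin 4 // q.1 < q.2}, (ρ (finTorusPlaquette
                    (fun e : FinTorusSite S S S (K + 1) × Fin 4 => if e.2 = Fin.last 3 then
                      (U ((e.1.1, e.1.2.1, e.1.2.2.1, Fin.rev e.1.2.2.2), Fin.last 3))⁻¹
                    else U ((e.1.1, e.1.2.1, e.1.2.2.1, ⟨(K + 1 - e.1.2.2.2.val) % (K + 1), Nat.mod_lt _ e.1.2.2.2.pos⟩), e.2))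
                    (q.toSite t) pl.1.1 pl.1.2)).trace.re) *
              Real.exp (-β * ∑ x : FinTorusSite S S S (K + 1), ∑ q : {q : Fin 4 × Fin 4 // q.1 < q.2},
                ((N : ℝ) - (ρ (finTorusPlaquette U x q.1.1 q.1.2)).trace.re))
              ∂(Measure.pi fun _ : FinTorusSite S S S (K + 1) × Fin 4 => haarProbability G)) /
              wilsonFinTorusPartition ρ β S S S (K + 1) *
            ((∫ U : FinTorusSite S S S (K + 1) × Fin 4 → G,
              (∑ t : Fin (K + 1), ∑ q : FinSpatialSite S S S, cf t q *
                  ∑ pl : {q : Fin 4 × Fin 4 // q.1 < q.2}, (ρ (finTorusPlaquette U (q.toSite t) pl.1.1 pl.1.2)).trace.re) *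
              Real.exp (-β * ∑ x : FinTorusSite S S S (K + 1), ∑ q : {q : Fin 4 × Fin 4 // q.1 < q.2},
                ((N : ℝ) - (ρ (finTorusPlaquette U x q.1.1 q.1.2)).trace.re))
              ∂(Measure.pi fun _ : FinTorusSite S S S (K + 1) × Fin 4 => haarProbability G)) /
              wilsonFinTorusPartition ρ β S S S (K + 1)) -
            W₀ * (∑ t : Fin (K + 1), ∑ q : FinSpatialSite S S S, cf t q) ^ 2) := by
  classical
  obtain ⟨C, hCcnt, d, Pk, Ut, ψk, γk, m₁, Gv, hCpos, hD, hP2, hP1, hG, hCS⟩ := exists_class_sums (S := S) ρ β hρ hρu hβ hK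
  haveI : Countable C := hCcnt.to_subtype
  obtain ⟨Z, hZdef⟩ : ∃ Z : ℝ, Z = wilsonFinTorusPartition ρ β S S S (K + 1) := ⟨_, rfl⟩
  have hZp : 0 < Z := hZdef ▸ wilsonFinTorusPartition_pos hρ β S S S (K + 1)
  rw [← hZdef] at hCS
  obtain ⟨lamk, hlamk⟩ : ∃ lamk : (Σ c : C, (Σ q : Fin 3 → ZMod S, Fin (d c q))) → ℝ, lamk = fun k => (k.1 : ℝ) := ⟨_, rfl⟩
  have hlampos : ∀ k, 0 < lamk k := fun k => by rw [hlamk]; exact hCpos k.1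
  have hW₀ : 0 ≤ Gv / Z - (m₁ / Z) ^ 2 := by
    rw [sub_nonneg, div_pow, div_le_div_iff₀ (pow_pos hZp 2) hZp]
    nlinarith [hCS, hZp]
  refine ⟨(Σ c : C, (Σ q : Fin 3 → ZMod S, Fin (d c q))), inferInstance, fun k => lamk k ^ (K - 1) / Z, Gv / Z - (m₁ / Z) ^ 2,
    Pk, Ut, ψk, fun k => div_nonneg (pow_nonneg (hlampos k).le _) hZp.le, hW₀, hD, ?_⟩
  intro h hh cf hcf
  -- §A abbreviations: momenta of sites, the site reflection, the site observables and the weight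
  obtain ⟨toZ, htoZ⟩ : ∃ toZ : FinSpatialSite S S S → (Fin 3 → ZMod S),
      toZ = fun q => ![ZMod.finEquiv S q.1, ZMod.finEquiv S q.2.1, ZMod.finEquiv S q.2.2] := ⟨_, rfl⟩
  obtain ⟨rf, hrf⟩ : ∃ rf : (FinTorusSite S S S (K + 1) × Fin 4 → G) → (FinTorusSite S S S (K + 1) × Fin 4 → G),
      rf = fun U e => if e.2 = Fin.last 3 then (U ((e.1.1, e.1.2.1, e.1.2.2.1, Fin.rev e.1.2.2.2), Fin.last 3))⁻¹
        else U ((e.1.1, e.1.2.1, e.1.2.2.1, ⟨(K + 1 - e.1.2.2.2.val) % (K + 1), Nat.mod_lt _ e.1.2.2.2.pos⟩), e.2) := ⟨_, rfl⟩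
  obtain ⟨Af, hAf⟩ : ∃ Af : Fin (K + 1) × FinSpatialSite S S S → (FinTorusSite S S S (K + 1) × Fin 4 → G) → ℝ,
      Af = fun x U => ∑ pl : {q : Fin 4 × Fin 4 // q.1 < q.2}, (ρ (finTorusPlaquette U (x.2.toSite x.1) pl.1.1 pl.1.2)).trace.re :=
    ⟨_, rfl⟩
  obtain ⟨wt, hwt⟩ : ∃ wt : (FinTorusSite S S S (K + 1) × Fin 4 → G) → ℝ,
      wt = fun U => Real.exp (-β * ∑ x : FinTorusSite S S S (K + 1), ∑ q : {q : Fin 4 × Fin 4 // q.1 < q.2},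
        ((N : ℝ) - (ρ (finTorusPlaquette U x q.1.1 q.1.2)).trace.re)) := ⟨_, rfl⟩
  have hAfc : ∀ x, Continuous (Af x) := fun x => by rw [hAf]; exact continuous_sitePlaquettes ρ hρ _
  have hrfc : Continuous rf := by rw [hrf]; exact continuous_reflCfg'
  have hwc : Continuous wt := by rw [hwt]; exact continuous_weight ρ β hρ
  -- the class sums in the abbreviations
  have hP2' : ∀ x y : Fin (K + 1) × FinSpatialSite S S S, 1 ≤ (x.1 : ℕ) → 1 ≤ (y.1 : ℕ) → (x.1 : ℕ) + (y.1 : ℕ) ≤ K - 2 →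
      HasSum (fun c : C => ((c : ℝ) : ℂ) ^ (K - 1) *
        ∑ j : (Σ q : Fin 3 → ZMod S, Fin (d c q)), ((((‖γk ⟨c, j⟩‖ ^ 2 : ℝ)) : ℂ) +
          ⟪(Pk ⟨c, j⟩ ^ ((x.1 : ℕ) - 1)) (Ut ⟨c, j⟩ (toZ x.2) (ψk ⟨c, j⟩)), (Pk ⟨c, j⟩ ^ ((y.1 : ℕ) - 1)) (Ut ⟨c, j⟩ (toZ y.2) (ψk ⟨c, j⟩))⟫_ℂ))
        (((∫ U, Af y U * Af x (rf U) * wt U ∂(Measure.pi fun _ : FinTorusSite S S S (K + 1) × Fin 4 => haarProbability G) : ℝ)) : ℂ) := by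
    intro x y hx hy hxy
    have h2 := hP2 x y hx hy hxy
    rw [htoZ, hAf, hrf, hwt]
    exact h2
  have hP1f : ∀ x : Fin (K + 1) × FinSpatialSite S S S, ∫ U, Af x U * wt U ∂(Measure.pi fun _ : FinTorusSite S S S (K + 1) × Fin 4 => haarProbability G) = m₁ := by
    intro x; have h1 := (hP1 x.1 x.2).1; rw [hAf, hwt]; exact h1
  have hP1r : ∀ x : Fin (K + 1) × FinSpatialSite S S S, ∫ U, Af x (rf U) * wt U ∂(Measure.pi fun _ : FinTorusSite S S S (K + 1) × Fin 4 => haarProbability G) = m₁ := by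
    intro x; have h1 := (hP1 x.1 x.2).2; rw [hAf, hrf, hwt]; exact h1
  -- §B the window and, per pair of sites, the two-point function with coefficients as a class sum
  have hwin : ∀ (t : Fin (K + 1)) (q : FinSpatialSite S S S), cf t q ≠ 0 → 1 ≤ (t : ℕ) ∧ (t : ℕ) ≤ h := fun t q hne => by
    by_contra hn; exact hne (hcf t q hn)
  have hpair : ∀ (x y : Fin (K + 1) × FinSpatialSite S S S),
      HasSum (fun c : C => ((cf x.1 x.2 * cf y.1 y.2 : ℝ) : ℂ) * (((c : ℝ) : ℂ) ^ (K - 1) *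
          ∑ j : (Σ q : Fin 3 → ZMod S, Fin (d c q)), ((((‖γk ⟨c, j⟩‖ ^ 2 : ℝ)) : ℂ) +
            ⟪(Pk ⟨c, j⟩ ^ ((x.1 : ℕ) - 1)) (Ut ⟨c, j⟩ (toZ x.2) (ψk ⟨c, j⟩)),
              (Pk ⟨c, j⟩ ^ ((y.1 : ℕ) - 1)) (Ut ⟨c, j⟩ (toZ y.2) (ψk ⟨c, j⟩))⟫_ℂ)))
        (((cf x.1 x.2 * cf y.1 y.2 * ∫ U, Af y U * Af x (rf U) * wt U ∂(Measure.pi fun _ : FinTorusSite S S S (K + 1) × Fin 4 => haarProbability G) : ℝ)) : ℂ) := by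
    intro x y
    by_cases hx : cf x.1 x.2 = 0
    · simp only [hx, zero_mul, Complex.ofReal_zero]; exact hasSum_zero
    by_cases hy : cf y.1 y.2 = 0
    · simp only [hy, mul_zero, zero_mul, Complex.ofReal_zero]; exact hasSum_zero
    obtain ⟨hx1, hxh⟩ := hwin x.1 x.2 hx
    obtain ⟨hy1, hyh⟩ := hwin y.1 y.2 hy
    have h3 := (hP2' x y hx1 hy1 (by omega)).mul_left (((cf x.1 x.2 * cf y.1 y.2 : ℝ)) : ℂ)
    rwa [← Complex.ofReal_mul] at h3
  -- §C integrability and the expansion of the three integrals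
  have hintp : ∀ (x y : Fin (K + 1) × FinSpatialSite S S S), Integrable (fun U => Af y U * Af x (rf U) * wt U) (Measure.pi fun _ : FinTorusSite S S S (K + 1) × Fin 4 => haarProbability G) :=
    fun x y => integrable_of_continuous_cfg (((hAfc y).mul ((hAfc x).comp hrfc)).mul hwc)
  have hintf : ∀ (y : Fin (K + 1) × FinSpatialSite S S S), Integrable (fun U => Af y U * wt U) (Measure.pi fun _ : FinTorusSite S S S (K + 1) × Fin 4 => haarProbability G) :=
    fun y => integrable_of_continuous_cfg ((hAfc y).mul hwc)
  have hintr : ∀ (x : Fin (K + 1) × FinSpatialSite S S S), Integrable (fun U => Af x (rf U) * wt U) (Measure.pi fun _ : FinTorusSite S S S (K + 1) × Fin 4 => haarProbability G) :=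
    fun x => integrable_of_continuous_cfg (((hAfc x).comp hrfc).mul hwc)
  have hI2tot := MixtureLemmas.integral_bilinear_sum (Measure.pi fun _ : FinTorusSite S S S (K + 1) × Fin 4 => haarProbability G)
    (fun x : Fin (K + 1) × FinSpatialSite S S S => cf x.1 x.2) (fun y : Fin (K + 1) × FinSpatialSite S S S => cf y.1 y.2)
    (fun x U => Af x (rf U)) (fun y U => Af y U) wt hintp
  have hI1f := MixtureLemmas.integral_linear_sum (Measure.pi fun _ : FinTorusSite S S S (K + 1) × Fin 4 => haarProbability G)
    (fun y : Fin (K + 1) × FinSpatialSite S S S => cf y.1 y.2) (fun y U => Af y U) wt hintf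
  have hI1r := MixtureLemmas.integral_linear_sum (Measure.pi fun _ : FinTorusSite S S S (K + 1) × Fin 4 => haarProbability G)
    (fun x : Fin (K + 1) × FinSpatialSite S S S => cf x.1 x.2) (fun x U => Af x (rf U)) wt hintr
  simp only [hP1f, hP1r, ← Finset.sum_mul] at hI1f hI1r
  -- §D the class-level sum over all pairs and its algebra
  have hsumC := hasSum_sum fun (xy : (Fin (K + 1) × FinSpatialSite S S S) × (Fin (K + 1) × FinSpatialSite S S S))
    (_ : xy ∈ Finset.univ) => hpair xy.1 xy.2
  have hgram : ∀ (c : C) (j : (Σ q : Fin 3 → ZMod S, Fin (d c q))),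
      (((‖∑ x : Fin (K + 1) × FinSpatialSite S S S, (cf x.1 x.2 : ℂ) •
          (Pk ⟨c, j⟩ ^ ((x.1 : ℕ) - 1)) (Ut ⟨c, j⟩ (toZ x.2) (ψk ⟨c, j⟩))‖ ^ 2 : ℝ)) : ℂ) =
        ∑ xy : (Fin (K + 1) × FinSpatialSite S S S) × (Fin (K + 1) × FinSpatialSite S S S), ((cf xy.1.1 xy.1.2 * cf xy.2.1 xy.2.2 : ℝ) : ℂ) *
          ⟪(Pk ⟨c, j⟩ ^ ((xy.1.1 : ℕ) - 1)) (Ut ⟨c, j⟩ (toZ xy.1.2) (ψk ⟨c, j⟩)),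
            (Pk ⟨c, j⟩ ^ ((xy.2.1 : ℕ) - 1)) (Ut ⟨c, j⟩ (toZ xy.2.2) (ψk ⟨c, j⟩))⟫_ℂ := by
    intro c j
    rw [MixtureLemmas.norm_sq_sum_smul_eq]
    exact (Fintype.sum_prod_type' (f := fun (a b : Fin (K + 1) × FinSpatialSite S S S) => ((cf a.1 a.2 * cf b.1 b.2 : ℝ) : ℂ) *
      ⟪(Pk ⟨c, j⟩ ^ ((a.1 : ℕ) - 1)) (Ut ⟨c, j⟩ (toZ a.2) (ψk ⟨c, j⟩)),
        (Pk ⟨c, j⟩ ^ ((b.1 : ℕ) - 1)) (Ut ⟨c, j⟩ (toZ b.2) (ψk ⟨c, j⟩))⟫_ℂ)).symm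
  have hsq : ∑ xy : (Fin (K + 1) × FinSpatialSite S S S) × (Fin (K + 1) × FinSpatialSite S S S),
      ((cf xy.1.1 xy.1.2 * cf xy.2.1 xy.2.2 : ℝ) : ℂ) = ((((∑ x : Fin (K + 1) × FinSpatialSite S S S, cf x.1 x.2) ^ 2 : ℝ)) : ℂ) := by
    rw [Fintype.sum_prod_type' (f := fun (a b : Fin (K + 1) × FinSpatialSite S S S) => ((cf a.1 a.2 * cf b.1 b.2 : ℝ) : ℂ))]
    push_cast
    rw [sq, Finset.sum_mul_sum]
  have halg : ∀ c : C, (∑ xy : (Fin (K + 1) × FinSpatialSite S S S) × (Fin (K + 1) × FinSpatialSite S S S),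
      ((cf xy.1.1 xy.1.2 * cf xy.2.1 xy.2.2 : ℝ) : ℂ) * (((c : ℝ) : ℂ) ^ (K - 1) *
        ∑ j : (Σ q : Fin 3 → ZMod S, Fin (d c q)), ((((‖γk ⟨c, j⟩‖ ^ 2 : ℝ)) : ℂ) +
          ⟪(Pk ⟨c, j⟩ ^ ((xy.1.1 : ℕ) - 1)) (Ut ⟨c, j⟩ (toZ xy.1.2) (ψk ⟨c, j⟩)),
            (Pk ⟨c, j⟩ ^ ((xy.2.1 : ℕ) - 1)) (Ut ⟨c, j⟩ (toZ xy.2.2) (ψk ⟨c, j⟩))⟫_ℂ))) =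
      ((c : ℝ) : ℂ) ^ (K - 1) * ((∑ j : (Σ q : Fin 3 → ZMod S, Fin (d c q)), (((‖γk ⟨c, j⟩‖ ^ 2 : ℝ)) : ℂ)) *
          ((((∑ x : Fin (K + 1) × FinSpatialSite S S S, cf x.1 x.2) ^ 2 : ℝ)) : ℂ) +
        ∑ j : (Σ q : Fin 3 → ZMod S, Fin (d c q)), (((‖∑ x : Fin (K + 1) × FinSpatialSite S S S, (cf x.1 x.2 : ℂ) •
          (Pk ⟨c, j⟩ ^ ((x.1 : ℕ) - 1)) (Ut ⟨c, j⟩ (toZ x.2) (ψk ⟨c, j⟩))‖ ^ 2 : ℝ)) : ℂ)) := by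
    intro c
    simp only [hgram, ← hsq]
    rw [Finset.sum_mul, ← Finset.sum_add_distrib, Finset.mul_sum]
    simp only [Finset.mul_sum, mul_add, Finset.sum_add_distrib]
    congr 1 <;> rw [Finset.sum_comm] <;>
      exact Finset.sum_congr rfl fun _ _ => Finset.sum_congr rfl fun _ _ => by ring
  -- §E the real class series of `∫ (B∘θ) B e^{−βS}` and the split of the variance part
  have hsumC' := hsumC
  simp only [halg] at hsumC'
  obtain ⟨I₂, hI₂⟩ : ∃ I : ℝ, I = ∫ U, (∑ x : Fin (K + 1) × FinSpatialSite S S S, cf x.1 x.2 * Af x (rf U)) *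
      (∑ y : Fin (K + 1) × FinSpatialSite S S S, cf y.1 y.2 * Af y U) * wt U ∂(Measure.pi fun _ : FinTorusSite S S S (K + 1) × Fin 4 => haarProbability G) := ⟨_, rfl⟩
  have hval2 : (∑ xy : (Fin (K + 1) × FinSpatialSite S S S) × (Fin (K + 1) × FinSpatialSite S S S),
      (((cf xy.1.1 xy.1.2 * cf xy.2.1 xy.2.2 * ∫ U, Af xy.2 U * Af xy.1 (rf U) * wt U ∂(Measure.pi fun _ : FinTorusSite S S S (K + 1) × Fin 4 => haarProbability G) : ℝ)) : ℂ)) =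
      ((I₂ : ℝ) : ℂ) := by
    rw [← Complex.ofReal_sum, hI₂, hI2tot, Fintype.sum_prod_type' (f := fun (x y : Fin (K + 1) × FinSpatialSite S S S) =>
      cf x.1 x.2 * cf y.1 y.2 * ∫ U, Af y U * Af x (rf U) * wt U ∂(Measure.pi fun _ : FinTorusSite S S S (K + 1) × Fin 4 => haarProbability G))]
  rw [hval2] at hsumC'
  obtain ⟨Sx, hSx⟩ : ∃ Sx : ℝ, Sx = ∑ x : Fin (K + 1) × FinSpatialSite S S S, cf x.1 x.2 := ⟨_, rfl⟩
  have hSx' : (∑ t : Fin (K + 1), ∑ q : FinSpatialSite S S S, cf t q) = Sx := by rw [hSx, Fintype.sum_prod_type']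
  rw [← hSx] at hsumC'
  have hfunR : (fun c : C => ((c : ℝ) : ℂ) ^ (K - 1) *
      ((∑ j : (Σ q : Fin 3 → ZMod S, Fin (d c q)), (((‖γk ⟨c, j⟩‖ ^ 2 : ℝ)) : ℂ)) * (((Sx ^ 2 : ℝ)) : ℂ) +
        ∑ j : (Σ q : Fin 3 → ZMod S, Fin (d c q)), (((‖∑ x : Fin (K + 1) × FinSpatialSite S S S, (cf x.1 x.2 : ℂ) •
          (Pk ⟨c, j⟩ ^ ((x.1 : ℕ) - 1)) (Ut ⟨c, j⟩ (toZ x.2) (ψk ⟨c, j⟩))‖ ^ 2 : ℝ)) : ℂ))) =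
      fun c : C => ((((c : ℝ) ^ (K - 1) * ((∑ j : (Σ q : Fin 3 → ZMod S, Fin (d c q)), ‖γk ⟨c, j⟩‖ ^ 2) * Sx ^ 2 +
        ∑ j : (Σ q : Fin 3 → ZMod S, Fin (d c q)), ‖∑ x : Fin (K + 1) × FinSpatialSite S S S, (cf x.1 x.2 : ℂ) •
          (Pk ⟨c, j⟩ ^ ((x.1 : ℕ) - 1)) (Ut ⟨c, j⟩ (toZ x.2) (ψk ⟨c, j⟩))‖ ^ 2) : ℝ)) : ℂ) := by
    funext c; push_cast; rfl
  rw [hfunR] at hsumC'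
  have hreal := Complex.hasSum_ofReal.1 hsumC'
  have hfin : HasSum (fun c : C => (c : ℝ) ^ (K - 1) / Z *
      ∑ j : (Σ q : Fin 3 → ZMod S, Fin (d c q)), ‖∑ x : Fin (K + 1) × FinSpatialSite S S S, (cf x.1 x.2 : ℂ) •
        (Pk ⟨c, j⟩ ^ ((x.1 : ℕ) - 1)) (Ut ⟨c, j⟩ (toZ x.2) (ψk ⟨c, j⟩))‖ ^ 2) ((I₂ - Sx ^ 2 * Gv) / Z) := by
    have h := (hreal.sub (hG.mul_left (Sx ^ 2))).div_const Z
    have hf : (fun c : C => ((c : ℝ) ^ (K - 1) * ((∑ j : (Σ q : Fin 3 → ZMod S, Fin (d c q)), ‖γk ⟨c, j⟩‖ ^ 2) * Sx ^ 2 +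
        ∑ j : (Σ q : Fin 3 → ZMod S, Fin (d c q)), ‖∑ x : Fin (K + 1) × FinSpatialSite S S S, (cf x.1 x.2 : ℂ) •
          (Pk ⟨c, j⟩ ^ ((x.1 : ℕ) - 1)) (Ut ⟨c, j⟩ (toZ x.2) (ψk ⟨c, j⟩))‖ ^ 2) -
        Sx ^ 2 * ((c : ℝ) ^ (K - 1) * ∑ j : (Σ q : Fin 3 → ZMod S, Fin (d c q)), ‖γk ⟨c, j⟩‖ ^ 2)) / Z) =
        fun c : C => (c : ℝ) ^ (K - 1) / Z *
          ∑ j : (Σ q : Fin 3 → ZMod S, Fin (d c q)), ‖∑ x : Fin (K + 1) × FinSpatialSite S S S, (cf x.1 x.2 : ℂ) •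
            (Pk ⟨c, j⟩ ^ ((x.1 : ℕ) - 1)) (Ut ⟨c, j⟩ (toZ x.2) (ψk ⟨c, j⟩))‖ ^ 2 := by
      funext c; ring
    rw [hf] at h; exact h
  -- §F to the countable index of reference states
  have hκ : HasSum (fun k : (Σ c : C, (Σ q : Fin 3 → ZMod S, Fin (d c q))) => lamk k ^ (K - 1) / Z *
      ‖∑ x : Fin (K + 1) × FinSpatialSite S S S, (cf x.1 x.2 : ℂ) •
        (Pk k ^ ((x.1 : ℕ) - 1)) (Ut k (toZ x.2) (ψk k))‖ ^ 2) ((I₂ - Sx ^ 2 * Gv) / Z) := by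
    refine MixtureLemmas.hasSum_sigma_of_nonneg_fibres ?_ (fun k => mul_nonneg (div_nonneg (pow_nonneg (hlampos k).le _) hZp.le) (sq_nonneg _))
    simp only [hlamk, ← Finset.mul_sum]
    exact hfin
  -- §G match the statement
  have hfam : (fun k : (Σ c : C, (Σ q : Fin 3 → ZMod S, Fin (d c q))) => lamk k ^ (K - 1) / Z *
      ‖∑ t : Fin (K + 1), ∑ q : FinSpatialSite S S S, (cf t q : ℂ) •
        (Pk k ^ ((t : ℕ) - 1)) (Ut k ![ZMod.finEquiv S q.1, ZMod.finEquiv S q.2.1, ZMod.finEquiv S q.2.2] (ψk k))‖ ^ 2) =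
      fun k => lamk k ^ (K - 1) / Z * ‖∑ x : Fin (K + 1) × FinSpatialSite S S S, (cf x.1 x.2 : ℂ) •
        (Pk k ^ ((x.1 : ℕ) - 1)) (Ut k (toZ x.2) (ψk k))‖ ^ 2 := by
    funext k
    rw [htoZ]
    have h := (Fintype.sum_prod_type' (fun (t : Fin (K + 1)) (q : FinSpatialSite S S S) => (cf t q : ℂ) •
      (Pk k ^ ((t : ℕ) - 1)) (Ut k ![ZMod.finEquiv S q.1, ZMod.finEquiv S q.2.1, ZMod.finEquiv S q.2.2] (ψk k)))).symm
    rw [h]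
  have hI2g : (∫ U : FinTorusSite S S S (K + 1) × Fin 4 → G,
      ((∑ t : Fin (K + 1), ∑ q : FinSpatialSite S S S, cf t q *
          ∑ pl : {q : Fin 4 × Fin 4 // q.1 < q.2}, (ρ (finTorusPlaquette
            (fun e : FinTorusSite S S S (K + 1) × Fin 4 => if e.2 = Fin.last 3 then
              (U ((e.1.1, e.1.2.1, e.1.2.2.1, Fin.rev e.1.2.2.2), Fin.last 3))⁻¹
            else U ((e.1.1, e.1.2.1, e.1.2.2.1, ⟨(K + 1 - e.1.2.2.2.val) % (K + 1), Nat.mod_lt _ e.1.2.2.2.pos⟩), e.2))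
            (q.toSite t) pl.1.1 pl.1.2)).trace.re) *
        (∑ t : Fin (K + 1), ∑ q : FinSpatialSite S S S, cf t q *
          ∑ pl : {q : Fin 4 × Fin 4 // q.1 < q.2}, (ρ (finTorusPlaquette U (q.toSite t) pl.1.1 pl.1.2)).trace.re)) *
      Real.exp (-β * ∑ x : FinTorusSite S S S (K + 1), ∑ q : {q : Fin 4 × Fin 4 // q.1 < q.2},
        ((N : ℝ) - (ρ (finTorusPlaquette U x q.1.1 q.1.2)).trace.re))
      ∂(Measure.pi fun _ : FinTorusSite S S S (K + 1) × Fin 4 => haarProbability G)) = I₂ := by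
    rw [hI₂]
    refine integral_congr_ae (Eventually.of_forall fun U => ?_)
    dsimp only
    rw [Fintype.sum_prod_type (f := fun x : Fin (K + 1) × FinSpatialSite S S S => cf x.1 x.2 * Af x (rf U)),
      Fintype.sum_prod_type (f := fun y : Fin (K + 1) × FinSpatialSite S S S => cf y.1 y.2 * Af y U)]
    simp only [hAf, hrf, hwt]
  have hI1f' : (∫ U : FinTorusSite S S S (K + 1) × Fin 4 → G,
      (∑ t : Fin (K + 1), ∑ q : FinSpatialSite S S S, cf t q *
          ∑ pl : {q : Fin 4 × Fin 4 // q.1 < q.2}, (ρ (finTorusPlaquette U (q.toSite t) pl.1.1 pl.1.2)).trace.re) *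
        Real.exp (-β * ∑ x : FinTorusSite S S S (K + 1), ∑ q : {q : Fin 4 × Fin 4 // q.1 < q.2},
          ((N : ℝ) - (ρ (finTorusPlaquette U x q.1.1 q.1.2)).trace.re))
      ∂(Measure.pi fun _ : FinTorusSite S S S (K + 1) × Fin 4 => haarProbability G)) = Sx * m₁ := by
    rw [hSx, ← hI1f]
    refine integral_congr_ae (Eventually.of_forall fun U => ?_)
    dsimp only
    rw [Fintype.sum_prod_type (f := fun y : Fin (K + 1) × FinSpatialSite S S S => cf y.1 y.2 * Af y U)]
    simp only [hAf, hwt]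
  have hI1r' : (∫ U : FinTorusSite S S S (K + 1) × Fin 4 → G,
      (∑ t : Fin (K + 1), ∑ q : FinSpatialSite S S S, cf t q *
          ∑ pl : {q : Fin 4 × Fin 4 // q.1 < q.2}, (ρ (finTorusPlaquette
            (fun e : FinTorusSite S S S (K + 1) × Fin 4 => if e.2 = Fin.last 3 then
              (U ((e.1.1, e.1.2.1, e.1.2.2.1, Fin.rev e.1.2.2.2), Fin.last 3))⁻¹
            else U ((e.1.1, e.1.2.1, e.1.2.2.1, ⟨(K + 1 - e.1.2.2.2.val) % (K + 1), Nat.mod_lt _ e.1.2.2.2.pos⟩), e.2))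
            (q.toSite t) pl.1.1 pl.1.2)).trace.re) *
        Real.exp (-β * ∑ x : FinTorusSite S S S (K + 1), ∑ q : {q : Fin 4 × Fin 4 // q.1 < q.2},
          ((N : ℝ) - (ρ (finTorusPlaquette U x q.1.1 q.1.2)).trace.re))
      ∂(Measure.pi fun _ : FinTorusSite S S S (K + 1) × Fin 4 => haarProbability G)) = Sx * m₁ := by
    rw [hSx, ← hI1r]
    refine integral_congr_ae (Eventually.of_forall fun U => ?_)
    dsimp only
    rw [Fintype.sum_prod_type (f := fun x : Fin (K + 1) × FinSpatialSite S S S => cf x.1 x.2 * Af x (rf U))]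
    simp only [hAf, hrf, hwt]
  rw [hfam, hI2g, hI1f', hI1r', hSx', ← hZdef]
  have hgoal : I₂ / Z - Sx * m₁ / Z * (Sx * m₁ / Z) - (Gv / Z - (m₁ / Z) ^ 2) * Sx ^ 2 = (I₂ - Sx ^ 2 * Gv) / Z := by
    field_simp; ring
  rw [hgoal]; exact hκ

end Summit.QuantumFields.YangMills.Theorems.TorusKL

end
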